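import Summits.ResolutionOfSingularities.ResolutionOfSingularities.Theorems.FrobeniusLadderFInjectiveMacaulayficationTCaFloorOneFull
import HarnessLib

/-!
# (RR-I2) THE POINT FLOOR OF `x² + y³ + u³ + t³ + s³` IS F-PURE ALONG THE FERMAT-CUBIC SURFACE FOR **EVERY** PRIME `p ≠ 3`: a `p`-UNIFORM DERIVATIVE CERTIFICATE
# (crux `FInjectiveMacaulayfication` stmt-ResolutionOfSingularities-15315, chain w45a; the LEGALITY / non-vacuity companion (L) of the second T″ kernel instance
# ✓ `X2Cubic4FloorTwoGlue.tStepInstanceAt_x2cubic4_origin`; engine = res-L1-w45a-stub-1 g12 / res-L1-w45a-idea-1 g26's generic-`p` ✓ `TCaFloorOneFull.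
# clause_at_maximal_of_derivative_certificate`; seat res-L1-w45a-lead-1 g11)

[OURS · L1 W4.5a] Support file (`--supports stmt-ResolutionOfSingularities-15315 --as helper`); def-free; UNCONDITIONAL; no named fact; NOT a statement of any manuscript.
AI-written (AI review is weaker than expert review).

THE CERTIFICATE (uniform in `p`). Chart polynomial `g = X₄² + X_a·w`, `w = 1 + X_b³ + X_c³ + X_d³` (`{a,b,c,d} = {0,1,2,3}`; the four singular charts of `Bl_𝔪 Y`,
`Y = {X₄² + X₀³ + X₁³ + X₂³ + X₃³}`, res-L1-w45a-lead-1 g10 ✓ `X2Cubic4PointFloor.theta`). For a set `T ∋ g^{p−1}` stable under all `∂/∂X_i`, `I = (T)`: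
(1) `I` is `∂`-stable (Leibniz); (2) `∂_a^{p−1}(g^{p−1}) = (p−1)!·w^{p−1}` (binomial expansion in `X_a·w` and `X₄²`, both `w` and `X₄` free of `X_a`; `∂_a^{p−1}` kills `X_a^i` for
`i < p−1`), so `w^{p−1} ∈ I` (Wilson-free: `p ∤ (p−1)!`); (3) DESCENT `w^{m+1} ∈ I ⇒ w^m ∈ I` while `p ∤ m+1`: `∂_b(w^{m+1}) = 3(m+1)·X_b²·w^m ∈ I`, so
`(X_b³ + X_c³ + X_d³)·w^m ∈ I` (`3`, `m+1` units) and `w^m = w^{m+1} − (X_b³ + X_c³ + X_d³)·w^m ∈ I`; (4) from `m = p−2` down to `0`: `1 ∈ I`.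
Hence (`TCaFloorOneFull.clause_at_maximal_of_derivative_certificate`) the crux's per-stalk FULL clause holds at EVERY closed point of each singular chart, for every prime
`p ≠ 3` and every field of characteristic `p`; the regular chart `D₊(x)` (`g₄ = 1 + X₄·q`) meets the exceptional divisor nowhere (`x̄ ∈ Q ⇒ 1 ∈ Q`), so its clause is vacuous
in the `hpts` form. The assembly into «the point floor is FULL at every stalk» is the next file.
* §1 `span_pderiv_mem`, `iterate_pderiv_mem`, `iterate_pderiv_X_pow_mul` (`∂_i^j (X_i^n·c) = n(n−1)⋯(n−j+1)·X_i^{n−j}·c` for `∂_i c = 0`);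
* §2 `g_pow_eq_sum`, `iterate_pderiv_g_pow` (= `(p−1)!·w^{p−1}`), `w_pow_mem` ; §3 `descent`, `one_mem_of_w_pow_mem`; §4 ★★ `hcert_chart` (the certificate, indices `a,b,c,d`
  abstract), ★★ `clause_chart` (the clause at every maximal ideal of `k[X]/(g)`), `clause_chartFour_vacuous`.
[cite: Fedder1983, Prop. 1.7 and Thm. 1.12] [folklore]
-/

-- single-problem summit: the doubled namespace component is forced
set_option linter.dupNamespace false

noncomputable section

open MvPolynomial

namespace Summit.ResolutionOfSingularities.ResolutionOfSingularities.Theorems.FInjectiveMacaulayfication.X2Cubic4FloorFullCert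

open Summit.ResolutionOfSingularities.ResolutionOfSingularities.Theorems.FInjectiveMacaulayfication

/-! ## §1 `∂`-stable sets and ideals; iterated partials of `X_i^n · c` -/

/-- **The ideal spanned by a `∂`-stable set is `∂`-stable** (Leibniz). [OURS · elementary] -/
theorem span_pderiv_mem {σ R : Type*} [CommRing R] (T : Set (MvPolynomial σ R)) (hT : ∀ s ∈ T, ∀ i : σ, pderiv i s ∈ T)
    (i : σ) {h : MvPolynomial σ R} (hh : h ∈ Ideal.span T) : pderiv i h ∈ Ideal.span T := by
  induction hh using Submodule.span_induction with
  | mem x hx => exact Ideal.subset_span (hT x hx i)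
  | zero => rw [map_zero]; exact Submodule.zero_mem _
  | add x y _ _ hx hy => rw [map_add]; exact Submodule.add_mem _ hx hy
  | smul a x hx' hx =>
      rw [smul_eq_mul, pderiv_mul]
      exact Submodule.add_mem _ (Ideal.mul_mem_left _ _ hx') (Ideal.mul_mem_left _ _ hx)

/-- Iterated partials stay in a `∂`-stable set. [plumbing] -/
theorem iterate_pderiv_mem {σ R : Type*} [CommRing R] (T : Set (MvPolynomial σ R)) (hT : ∀ s ∈ T, ∀ i : σ, pderiv i s ∈ T) (i : σ) :
    ∀ (j : ℕ) {h : MvPolynomial σ R}, h ∈ T → (fun q => pderiv i q)^[j] h ∈ T := by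
  intro j
  induction j with
  | zero => intro h hh; exact hh
  | succ j ih => intro h hh; rw [Function.iterate_succ_apply']; exact hT _ (ih hh) i

/-- **`∂_i^j (X_i^n · c) = n(n−1)⋯(n−j+1) · X_i^{n−j} · c`** for `∂_i c = 0` (descending factorial; `0` once `j > n`). [folklore] -/
theorem iterate_pderiv_X_pow_mul {σ R : Type*} [CommRing R] [DecidableEq σ] (i : σ) (c : MvPolynomial σ R) (hc : pderiv i c = 0) :
    ∀ (j n : ℕ), (fun q => pderiv i q)^[j] (X i ^ n * c) = (n.descFactorial j : MvPolynomial σ R) * (X i ^ (n - j) * c) := by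
  intro j
  induction j with
  | zero => intro n; simp
  | succ j ih =>
      intro n
      rw [Function.iterate_succ_apply', ih n, Nat.descFactorial_succ, ← Nat.sub_sub]
      simp only [Derivation.leibniz, Derivation.map_natCast, Derivation.leibniz_pow, pderiv_X_self, hc, smul_eq_mul, mul_one, nsmul_eq_mul]
      push_cast
      ring

/-! ## §2 The chart polynomial `g = X₄² + X_a·w`: `∂_a^{p−1}(g^{p−1}) = (p−1)!·w^{p−1}` -/

variable (k : Type) [Field k]

/-- `g^{p−1}` by the binomial theorem in `X_a·w` and `X₄²`. [plumbing] -/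
theorem g_pow_eq_sum (p : ℕ) (hp : 0 < p) (a : Fin 5) (g w : MvPolynomial (Fin 5) k) (hg : g = X 4 ^ 2 + X a * w) :
    g ^ (p - 1) = (Finset.range p).sum fun i => ((p - 1).choose i : MvPolynomial (Fin 5) k) * (X a ^ i * (w ^ i * (X 4 ^ 2) ^ (p - 1 - i))) := by
  have hp1 : p - 1 + 1 = p := Nat.sub_add_cancel hp
  rw [hg, add_comm (X 4 ^ 2) _, add_pow, hp1]
  refine Finset.sum_congr rfl fun i _ => ?_
  rw [mul_pow]
  ring

/-- `∂_a` kills `w^i · (X₄²)^j` when `w` and `X₄` are free of `X_a`. [plumbing] -/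
theorem pderiv_w_pow_mul_eq_zero (a : Fin 5) (ha4 : a ≠ 4) (w : MvPolynomial (Fin 5) k) (hwa : pderiv a w = 0) (i j : ℕ) :
    pderiv a (w ^ i * (X 4 ^ 2) ^ j) = 0 := by
  simp only [Derivation.leibniz, Derivation.leibniz_pow, hwa, pderiv_X_of_ne ha4.symm, smul_zero, add_zero]

/-- ★ **`∂_a^{p−1}(g^{p−1}) = (p−1)!·w^{p−1}`.** [folklore computation] -/
theorem iterate_pderiv_g_pow (p : ℕ) (hp : 0 < p) (a : Fin 5) (ha4 : a ≠ 4) (g w : MvPolynomial (Fin 5) k) (hg : g = X 4 ^ 2 + X a * w)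
    (hwa : pderiv a w = 0) :
    (fun q => pderiv a q)^[p - 1] (g ^ (p - 1)) = ((p - 1).factorial : MvPolynomial (Fin 5) k) * w ^ (p - 1) := by
  -- the iterate as a power of the linear map `∂_a`
  have hL : ∀ (j : ℕ) (q : MvPolynomial (Fin 5) k),
      (fun q => pderiv a q)^[j] q = ((pderiv a : Derivation k (MvPolynomial (Fin 5) k) (MvPolynomial (Fin 5) k)).toLinearMap ^ j) q := by
    intro j q
    rw [Module.End.pow_apply]
    rfl
  rw [g_pow_eq_sum k p hp a g w hg, hL, map_sum]
  rw [Finset.sum_eq_single (p - 1)]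
  · rw [← nsmul_eq_mul, map_nsmul, ← hL, iterate_pderiv_X_pow_mul a _ (pderiv_w_pow_mul_eq_zero k a ha4 w hwa (p - 1) (p - 1 - (p - 1))) (p - 1) (p - 1),
      Nat.choose_self, Nat.descFactorial_self, Nat.sub_self]
    simp
  · intro i hi hne
    have hlt : i < p - 1 := lt_of_le_of_ne (Nat.le_sub_one_of_lt (Finset.mem_range.mp hi)) hne
    rw [← nsmul_eq_mul, map_nsmul, ← hL, iterate_pderiv_X_pow_mul a _ (pderiv_w_pow_mul_eq_zero k a ha4 w hwa i (p - 1 - i)) (p - 1) i,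
      (Nat.descFactorial_eq_zero_iff_lt).mpr hlt]
    simp
  · intro h
    exact absurd (Finset.mem_range.mpr (Nat.sub_lt hp Nat.one_pos)) h

/-- **`w^{p−1} ∈ (T)`** for every `∂`-stable `T ∋ g^{p−1}` (`p` prime: `p ∤ (p−1)!`). [OURS · step (2)] -/
theorem w_pow_mem (p : ℕ) [Fact p.Prime] [CharP k p] (a : Fin 5) (ha4 : a ≠ 4) (g w : MvPolynomial (Fin 5) k) (hg : g = X 4 ^ 2 + X a * w)
    (hwa : pderiv a w = 0) (T : Set (MvPolynomial (Fin 5) k)) (hgT : g ^ (p - 1) ∈ T) (hT : ∀ s ∈ T, ∀ i : Fin 5, pderiv i s ∈ T) :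
    w ^ (p - 1) ∈ Ideal.span T := by
  have hp : 0 < p := (Fact.out : p.Prime).pos
  have hmem : ((p - 1).factorial : MvPolynomial (Fin 5) k) * w ^ (p - 1) ∈ Ideal.span T := by
    rw [← iterate_pderiv_g_pow k p hp a ha4 g w hg hwa]
    exact Ideal.subset_span (iterate_pderiv_mem T hT a (p - 1) hgT)
  have hfac : (((p - 1).factorial : ℕ) : k) ≠ 0 := by
    rw [Ne, CharP.cast_eq_zero_iff k p]
    rw [(Fact.out : p.Prime).dvd_factorial]
    omega
  have := Ideal.mul_mem_left _ (C ((((p - 1).factorial : ℕ) : k)⁻¹)) hmem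
  rwa [← mul_assoc, ← map_natCast (C : k →+* MvPolynomial (Fin 5) k), ← map_mul, inv_mul_cancel₀ hfac, map_one, one_mul] at this

/-! ## §3 The descent `w^{m+1} ∈ I ⇒ w^m ∈ I` -/

/-- `∂_b w = 3X_b²` for `w = 1 + X_b³ + X_c³ + X_d³`, `b ∉ {c, d}`. [plumbing] -/
theorem pderiv_w (b c d : Fin 5) (hbc : b ≠ c) (hbd : b ≠ d) (w : MvPolynomial (Fin 5) k) (hw : w = 1 + X b ^ 3 + X c ^ 3 + X d ^ 3) :
    pderiv b w = 3 * X b ^ 2 := by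
  rw [hw]
  simp only [map_add, Derivation.map_one_eq_zero, Derivation.leibniz_pow, pderiv_X_self, pderiv_X_of_ne hbc.symm, pderiv_X_of_ne hbd.symm,
    zero_add, smul_eq_mul, mul_one, nsmul_eq_mul]
  ring

/-- One variable's contribution: `w^{m+1} ∈ I`, `∂_b w = 3X_b²`, `3` and `m+1` units ⇒ `X_b³·w^m ∈ I`. [OURS · step (3)] -/
theorem X_cube_mul_w_pow_mem (p : ℕ) [CharP k p] (h3 : (3 : k) ≠ 0) (b : Fin 5) (w : MvPolynomial (Fin 5) k) (hwb : pderiv b w = 3 * X b ^ 2)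
    (T : Set (MvPolynomial (Fin 5) k)) (hT : ∀ s ∈ T, ∀ i : Fin 5, pderiv i s ∈ T) (m : ℕ) (hm : ((m + 1 : ℕ) : k) ≠ 0)
    (hwI : w ^ (m + 1) ∈ Ideal.span T) : X b ^ 3 * w ^ m ∈ Ideal.span T := by
  have hd := span_pderiv_mem T hT b hwI
  rw [Derivation.leibniz_pow, hwb, Nat.add_sub_cancel, smul_eq_mul, nsmul_eq_mul] at hd
  -- `hd : ↑(m+1) * (w^m * (3 * X_b²)) ∈ I`; cancel the unit `3(m+1)`
  have hu : ((m + 1 : ℕ) : k) * 3 ≠ 0 := mul_ne_zero hm h3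
  have h2 : X b ^ 2 * w ^ m ∈ Ideal.span T := by
    have := Ideal.mul_mem_left _ (C ((((m + 1 : ℕ) : k) * 3)⁻¹)) hd
    have e : C ((((m + 1 : ℕ) : k) * 3)⁻¹) * (((m + 1 : ℕ) : MvPolynomial (Fin 5) k) * (w ^ m * (3 * X b ^ 2))) =
        C (((((m + 1 : ℕ) : k) * 3)⁻¹) * (((m + 1 : ℕ) : k) * 3)) * (X b ^ 2 * w ^ m) := by
      rw [map_mul C, map_mul C, map_natCast C, map_ofNat C]
      ring
    rwa [e, inv_mul_cancel₀ hu, map_one, one_mul] at this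
  have := Ideal.mul_mem_left _ (X b) h2
  have e : X b * (X b ^ 2 * w ^ m) = X b ^ 3 * w ^ m := by ring
  rwa [e] at this

/-- ★ **THE DESCENT**: `w^{m+1} ∈ I ⇒ w^m ∈ I` (`w = 1 + X_b³ + X_c³ + X_d³`, `b,c,d` distinct; `3`, `m+1` units): `(X_b³ + X_c³ + X_d³)·w^m ∈ I` and
`w^m = w^{m+1} − (X_b³ + X_c³ + X_d³)·w^m`. [OURS · step (3)] -/
theorem descent (p : ℕ) [CharP k p] (h3 : (3 : k) ≠ 0) (b c d : Fin 5) (hbc : b ≠ c) (hbd : b ≠ d) (hcd : c ≠ d)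
    (w : MvPolynomial (Fin 5) k) (hw : w = 1 + X b ^ 3 + X c ^ 3 + X d ^ 3)
    (T : Set (MvPolynomial (Fin 5) k)) (hT : ∀ s ∈ T, ∀ i : Fin 5, pderiv i s ∈ T) (m : ℕ) (hm : ((m + 1 : ℕ) : k) ≠ 0)
    (hwI : w ^ (m + 1) ∈ Ideal.span T) : w ^ m ∈ Ideal.span T := by
  have hb := X_cube_mul_w_pow_mem k p h3 b w (pderiv_w k b c d hbc hbd w hw) T hT m hm hwI
  have hc := X_cube_mul_w_pow_mem k p h3 c w (pderiv_w k c b d hbc.symm hcd w (by rw [hw]; ring)) T hT m hm hwI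
  have hd' := X_cube_mul_w_pow_mem k p h3 d w (pderiv_w k d b c hbd.symm hcd.symm w (by rw [hw]; ring)) T hT m hm hwI
  have e : w ^ m = w ^ (m + 1) - (X b ^ 3 * w ^ m + X c ^ 3 * w ^ m + X d ^ 3 * w ^ m) := by rw [pow_succ, hw]; ring
  rw [e]
  exact Ideal.sub_mem _ hwI (Ideal.add_mem _ (Ideal.add_mem _ hb hc) hd')

/-- **From `w^{p−1} ∈ I` down to `1 ∈ I`**: all of `1, …, p−1` are units modulo `p`. [OURS · step (4)] -/
theorem one_mem_of_w_pow_mem (p : ℕ) [Fact p.Prime] [CharP k p] (h3 : (3 : k) ≠ 0) (b c d : Fin 5) (hbc : b ≠ c) (hbd : b ≠ d) (hcd : c ≠ d)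
    (w : MvPolynomial (Fin 5) k) (hw : w = 1 + X b ^ 3 + X c ^ 3 + X d ^ 3)
    (T : Set (MvPolynomial (Fin 5) k)) (hT : ∀ s ∈ T, ∀ i : Fin 5, pderiv i s ∈ T) (hwI : w ^ (p - 1) ∈ Ideal.span T) :
    (1 : MvPolynomial (Fin 5) k) ∈ Ideal.span T := by
  have key : ∀ j : ℕ, j ≤ p - 1 → w ^ (p - 1 - j) ∈ Ideal.span T := by
    intro j
    induction j with
    | zero => intro _; simpa using hwI
    | succ j ih =>
        intro hj
        have hprev := ih (Nat.le_of_succ_le hj)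
        have hm : p - 1 - j = (p - 1 - (j + 1)) + 1 := by omega
        rw [hm] at hprev
        refine descent k p h3 b c d hbc hbd hcd w hw T hT _ ?_ hprev
        rw [Ne, CharP.cast_eq_zero_iff k p]
        intro hdvd
        have := Nat.le_of_dvd (by omega) hdvd
        omega
  have := key (p - 1) le_rfl
  rwa [Nat.sub_self, pow_zero] at this

/-! ## §4 The certificate and the clause, per singular chart; the regular chart is vacuous -/

/-- ★★ **THE `p`-UNIFORM DERIVATIVE CERTIFICATE** for `g = X₄² + X_a(1 + X_b³ + X_c³ + X_d³)` (`a ∉ {b, c, d, 4}`, `b, c, d` pairwise distinct): for every prime `p ≠ 3` (i.e. `3 ≠ 0` in `k`) and every `∂`-stable set `T ∋ g^{p−1}`, `1 ∈ (T)`. [OURS; cite: Fedder1983, Thm. 1.12 (context)] -/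
theorem hcert_chart (p : ℕ) [Fact p.Prime] [CharP k p] (h3 : (3 : k) ≠ 0) (a b c d : Fin 5) (ha4 : a ≠ 4) (hab : a ≠ b) (hac : a ≠ c) (had : a ≠ d)
    (hbc : b ≠ c) (hbd : b ≠ d) (hcd : c ≠ d) (g : MvPolynomial (Fin 5) k) (hg : g = X 4 ^ 2 + X a * (1 + X b ^ 3 + X c ^ 3 + X d ^ 3)) :
    ∀ T : Set (MvPolynomial (Fin 5) k), g ^ (p - 1) ∈ T → (∀ s ∈ T, ∀ i : Fin 5, pderiv i s ∈ T) → (1 : MvPolynomial (Fin 5) k) ∈ Ideal.span T := by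
  intro T hgT hT
  have hwa : pderiv a (1 + X b ^ 3 + X c ^ 3 + X d ^ 3 : MvPolynomial (Fin 5) k) = 0 := by
    simp only [map_add, Derivation.map_one_eq_zero, Derivation.leibniz_pow, pderiv_X_of_ne hab.symm, pderiv_X_of_ne hac.symm, pderiv_X_of_ne had.symm,
      smul_zero, add_zero]
  exact one_mem_of_w_pow_mem k p h3 b c d hbc hbd hcd _ rfl T hT (w_pow_mem k p a ha4 g _ hg hwa T hgT hT)

/-- ★★ **THE FULL CLAUSE AT EVERY CLOSED POINT OF A SINGULAR CHART**, for every prime `p` with `3 ≠ 0` in `k`: the crux's per-stalk clause (parameter ideals are CM-regular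
sequences and Frobenius closed) at every maximal ideal of `k[X]/(g)`, `g = X₄² + X_a(1 + X_b³ + X_c³ + X_d³)` — exactly the `hpts` input of
`GermOfGlobalBlowup.hypersurfacePointBlowup_fullCl`, via `TCaFloorOneFull.clause_at_maximal_of_derivative_certificate`. [OURS · assembly; cite: Fedder1983, Prop. 1.7, Thm. 1.12] -/
theorem clause_chart (p : ℕ) [Fact p.Prime] [CharP k p] (h3 : (3 : k) ≠ 0) (a b c d : Fin 5) (ha4 : a ≠ 4) (hab : a ≠ b) (hac : a ≠ c) (had : a ≠ d)
    (hbc : b ≠ c) (hbd : b ≠ d) (hcd : c ≠ d) (g : MvPolynomial (Fin 5) k) (hg : g = X 4 ^ 2 + X a * (1 + X b ^ 3 + X c ^ 3 + X d ^ 3))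
    (Q : Ideal (MvPolynomial (Fin 5) k ⧸ Ideal.span {g})) [Q.IsMaximal] :
    ∀ e : ℕ, ringKrullDim (Localization.AtPrime Q) = e → ∀ s : Fin e → Localization.AtPrime Q,
      (Ideal.span (Set.range s)).radical.IsMaximal →
        RingTheory.Sequence.IsWeaklyRegular (Localization.AtPrime Q) (List.ofFn s) ∧
        ∀ y : Localization.AtPrime Q, (∃ n : ℕ, y ^ p ^ n ∈ Ideal.span
          ((fun z : Localization.AtPrime Q => z ^ p ^ n) ''
            (Ideal.span (Set.range s) : Set (Localization.AtPrime Q)))) → y ∈ Ideal.span (Set.range s) := by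
  have hg0 : g ≠ 0 := by
    intro h0
    have := congrArg (MvPolynomial.eval (Pi.single 4 1 : Fin 5 → k)) h0
    rw [hg] at this
    simp [Pi.single_apply, ha4] at this
  exact TCaFloorOneFull.clause_at_maximal_of_derivative_certificate p k g hg0 (hcert_chart k p h3 a b c d ha4 hab hac had hbc hbd hcd g hg) Q

/-- **The regular chart `D₊(x)` meets the exceptional divisor nowhere**: no maximal (indeed no proper) ideal of `k[X]/(1 + X₄·q)` contains `x̄₄` — so the `hpts` clause of
`GermOfGlobalBlowup.hypersurfacePointBlowup_fullCl` is vacuous on chart `4`. [OURS · elementary] -/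
theorem chartFour_X_not_mem (g₄ q : MvPolynomial (Fin 5) k) (hg₄ : g₄ = 1 + X 4 * q) (Q : Ideal (MvPolynomial (Fin 5) k ⧸ Ideal.span {g₄})) (hQ : Q ≠ ⊤) :
    Ideal.Quotient.mk (Ideal.span {g₄}) (X 4) ∉ Q := by
  intro h4
  apply hQ
  rw [Ideal.eq_top_iff_one]
  have e : (1 : MvPolynomial (Fin 5) k ⧸ Ideal.span {g₄}) = -(Ideal.Quotient.mk (Ideal.span {g₄}) (X 4) * Ideal.Quotient.mk (Ideal.span {g₄}) q) := by
    rw [← map_mul, ← map_neg, ← (Ideal.Quotient.mk (Ideal.span {g₄})).map_one, Ideal.Quotient.eq, Ideal.mem_span_singleton]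
    exact ⟨1, by rw [hg₄]; ring⟩
  rw [e]
  exact Q.neg_mem (Q.mul_mem_right _ h4)

end Summit.ResolutionOfSingularities.ResolutionOfSingularities.Theorems.FInjectiveMacaulayfication.X2Cubic4FloorFullCert

end
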